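import Summits.ValiantsHypothesis.ValiantsHypothesis.Theorems.NewtonUnitEquationsTwoProductsRankOneThreeLawFree
import HarnessLib

/-!
# Route NewtonUnitEquations — crux `TwoProducts` (stmt-ValiantsHypothesis-5906), line `relation_ladder`, rung R6b (three-term
# rank one, shape `α = β + γ`): the FREE LIFT — `RankOneThreeLaw`, UNCONDITIONAL — part 2/6 — the slice functions `F_b` and THE COEFFICIENT THEOREM for the free lift of the truncated logarithm (Part T4)

(T4) the slice functions `Fsl` (NOT of bounded binomial width: the factor `C(λ(ν) + b - 1 - k, b - k)`), per-term evaluation, THE COEFFICIENT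
THEOREM `coeff_free_logTrunc` (non-exceptional exponents) and `coeff_free_logTrunc_exc` (exceptional exponents `x = b · e_c`), the support
criterion `mem_support_free_logTrunc_iff`, the shape lemma and the slice/reduced-part bijection `xOf`.

val-idea-8 g3 (ideator; lens decomp), 2026-08-28. Companion of the R6 module (shape `α + β = γ + δ`, Segre lift). New ingredient: the
relation is INHOMOGENEOUS, so the fibres of the lift `Y_α ↦ Y_β Y_γ` have VARYING letter count and the slice sums are no longer
binomial-exponential sums of bounded width; they carry the extra factor `C(λ(ν) + b - 1 - k, b - k)` with `λ` an ADDITIVE form, which still has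
finite SHIFT RANK — so val-lit-p3's general strict-pencil-minimiser count for finite shift rank (`…FormalLogLinearisation.ShiftRank.pencilCount`,
LANDED p620579) applies BY NAME.

PORT NOTE (val-lit-p3 g15, prover seat, helper mode `--supports stmt-ValiantsHypothesis-5906 --as helper`, no stub credit claimed;
desk RULING #279 (c)): part 2/6 of a VERBATIM Theorems-side port of val-idea-8 g3's sorry-free module
`Cruxes/TwoProducts/Lines/relation_ladder_R6b.lean` (tree @988ccfe3a7f4; file sha256 da7520fdfde8796f…; 1 661 lines; `lean check` rc 0,
0 sorries) into files of ≤ 400 lines, following the R6 port (`…RankOneFourLaw{Toric,Fibres,Slice,Planar,Weights,Count}`, p11 g1 / p3 g14).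
ALL mathematics and ALL proofs below are val-idea-8 g3's (engine memo `Cruxes/TwoProducts/Lines/relation_ladder_R6_engine.md` rev 3 §7′,
card `Lines/relation_ladder.md` v14). The port changes only: (i) the file split and the import chain; (ii) the generic toolkit that the source
re-declares VERBATIM from the R6 module (`phiT/piT` family, `piT_apply`, `ofFun`, `multinomial_univ`, `tab`, `sgn`, `binChar` + lemmas,
`toolBound_mono`, the toric Lemma A `toric_minLog` with `coeff_zero_phiT_lin/coeff_zero_one_add_phiT_lin/phiT_liftG/phiT_logTrunc`,
`RankOneCoincidences`, `rankOneCoincidences_of_permType`, `msetT_apply_eq_zero`, `idxOf`, `enum_idxOf`, `rW`, `lwt_single`, `lwt_piT`) is NOT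
re-declared but IMPORTED from the landed R6 port (`…RankOneFourLaw*`, namespace `…PermutationType`, identical texts), so every such name below
resolves to the landed declaration; (iii) `set_option linter.deprecated false` dropped; (iv) one-line docstrings on API lemmas required by the
tree's docstring lint; (v) in part 6/6 the parameter-free `def RankOneThreeLaw : Prop` is NOT declared (the gate relocates such defs, cf. the R6
port delta p622844) — the law is stated by its LITERAL body as `rankOneThreeLaw_proof`. Namespace = the author's (`…PermutationType.R6b`).
Nothing here closes the line's residual, the crux `TwoProducts` (5906) or `VP ≠ VNP`; no summit statement is proved.

Honest scope (the author's): the shape `2β = α + γ` (R6c) and coincidence rank `≥ 2` (R7) are NOT covered here and go to the residual of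
skeleton v15. Nothing here moves VP ≠ VNP; `TwoProducts` (5906) stays OPEN. [folklore]
-/

noncomputable section

-- Sub = Summit single-conjunct layout: the duplicated namespace component is mandated by the tree.
set_option linter.dupNamespace false
set_option linter.unusedSimpArgs false
set_option linter.unusedSectionVars false

namespace Summit.ValiantsHypothesis.ValiantsHypothesis.Theorems.NewtonUnitEquations.TwoProducts.PermutationType
namespace R6b
open scoped BigOperators
open MvPolynomial

variable {σ : Type*} [Fintype σ] [DecidableEq σ]

variable (I : ThreeIdx σ)

/-! ## Part T4: the slice functions `F_b` (NOT of bounded binomial width: the factor `C(λ(ν) + b - 1 - k, b - k)`) and THE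
COEFFICIENT THEOREM for the free lift of the truncated logarithm -/

section Slice
variable {m : ℕ}

omit [Fintype σ] [DecidableEq σ] in
/-- The signs of the `2m` atoms sum to zero. [folklore] -/
theorem sum_sgn : ∑ j, sgn m j = 0 := by
  rw [Fintype.sum_sum_type]; simp [sgn]


/-- The slice indicator `[ν_a = 0] [ν_c = 0]`. [folklore] -/
def ind (ν : σ → ℕ) : ℂ := if ν I.a = 0 ∧ ν I.c = 0 then 1 else 0

/-- The ADDITIVE letter-count form `λ(ν) = Σ_{j ∉ {a, c}} ν_j`. [folklore] -/
def lam (ν : σ → ℕ) : ℕ := (∑ j ∈ rest I, ν j) + ν I.b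

/-- The exponential factor over the untouched letters. [folklore] -/
def restProd (t : σ → ℂ) (ν : σ → ℕ) : ℂ := ∏ j ∈ rest I, t j ^ ν j

/-- The `(j, k)` term of the slice function `F_b`:
`± (-1)^k c_{jα}^k c_{jγ}^{b-k} · C(ν_β, k) c_{jβ}^{ν_β - k} · ∏_rest c_{je}^{ν_e} · C(λ(ν) + b - 1 - k, b - k)`. [folklore] -/
def mainTerm (c d : Fin m → σ → ℂ) (b₀ : ℕ) (j : Fin m ⊕ Fin m) (k : ℕ) (ν : σ → ℕ) : ℂ :=
  (sgn m j * (-1) ^ k * tab c d j I.a ^ k * tab c d j I.c ^ (b₀ - k)) *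
    ((binChar (tab c d j I.b) k (ν I.b) * restProd I (tab c d j) ν) *
      (((lam I ν + (b₀ - 1 - k)).choose (b₀ - k) : ℕ) : ℂ))

/-- The correction at the exceptional point `ν = 0` of the slice (the pure power `Y_γ^b`). [folklore] -/
def corr (c d : Fin m → σ → ℂ) (b₀ : ℕ) (ν : σ → ℕ) : ℂ :=
  if (∀ j, ν j = 0) then ∑ j, sgn m j * tab c d j I.c ^ b₀ else 0

/-- **The slice function** `F_b` of the free lift of the truncated logarithm. [folklore] -/
def Fsl (c d : Fin m → σ → ℂ) (b₀ : ℕ) (ν : σ → ℕ) : ℂ :=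
  ind I ν * (∑ j : Fin m ⊕ Fin m, ∑ k : Fin (b₀ + 1), mainTerm I c d b₀ j k ν) + corr I c d b₀ ν

/-- The letter-count form at a reduced exponent is its degree. [folklore] -/
theorem lam_xhat (x : σ →₀ ℕ) : lam I ⇑(xhat I x) = deg (xhat I x) := by
  rw [deg_xhat]; unfold lam
  rw [xhat_b]
  congr 1
  refine Finset.sum_congr rfl fun j hj => ?_
  rw [mem_rest] at hj
  exact xhat_other I x j hj.1 hj.2.2

/-- The rest-product at a reduced exponent. [folklore] -/
theorem restProd_xhat (t : σ → ℂ) (x : σ →₀ ℕ) : restProd I t ⇑(xhat I x) = ∏ j ∈ rest I, t j ^ x j := by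
  unfold restProd
  refine Finset.prod_congr rfl fun j hj => ?_
  rw [mem_rest] at hj
  rw [xhat_other I x j hj.1 hj.2.2]

/-- Moments along the fibre. [folklore] -/
theorem mom_Lof (t : σ → ℂ) (x : σ →₀ ℕ) (k : ℕ) :
    mom t (Lof I x k) = (∏ j ∈ rest I, t j ^ x j) * (t I.a ^ k * (t I.b ^ (x I.b - k) * t I.c ^ (x I.c - k))) := by
  unfold mom
  rw [prod_three_split I, Lof_a, Lof_b, Lof_c]
  congr 1
  refine Finset.prod_congr rfl fun j hj => ?_
  rw [mem_rest] at hj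
  rw [Lof_other I x k j hj.1 hj.2.1 hj.2.2]

/-- The slice indicator at a reduced exponent is `1`. [folklore] -/
theorem ind_xhat (x : σ →₀ ℕ) : ind I ⇑(xhat I x) = 1 := by
  unfold ind; rw [xhat_a, xhat_c, if_pos ⟨rfl, rfl⟩]

/-- The correction vanishes at non-exceptional reduced exponents. [folklore] -/
theorem corr_xhat (c d : Fin m → σ → ℂ) (b₀ : ℕ) (x : σ →₀ ℕ) (h1 : 1 ≤ deg (xhat I x)) :
    corr I c d b₀ ⇑(xhat I x) = 0 := by
  unfold corr
  rw [if_neg]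
  intro h
  have : xhat I x = 0 := by ext j; exact h j
  rw [this] at h1
  simp [deg_eq_sum] at h1

/-- **Per-term evaluation** of the slice function at a reduced exponent. [folklore] -/
theorem mainTerm_xhat (c d : Fin m → σ → ℂ) (x : σ →₀ ℕ) (j : Fin m ⊕ Fin m) (k : ℕ) :
    mainTerm I c d (x I.c) j k ⇑(xhat I x) = sgn m j * (((-1 : ℂ) ^ k *
      (((x I.b).choose k * (deg (xhat I x) + (x I.c - 1 - k)).choose (x I.c - k) : ℕ) : ℂ)) *
        mom (tab c d j) (Lof I x k)) := by
  unfold mainTerm binChar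
  rw [xhat_b, lam_xhat, restProd_xhat, mom_Lof]
  push_cast
  ring

/-- **The slice function at a reduced exponent** is the signed-binomially weighted fibre sum of moment differences. [folklore] -/
theorem Fsl_xhat_eq (c d : Fin m → σ → ℂ) (x : σ →₀ ℕ) (h1 : 1 ≤ deg (xhat I x)) :
    Fsl I c d (x I.c) ⇑(xhat I x) = ∑ k ∈ Finset.range (x I.c + 1),
      ((-1 : ℂ) ^ k * (((x I.b).choose k * (deg (xhat I x) + (x I.c - 1 - k)).choose (x I.c - k) : ℕ) : ℂ)) *
        (∑ j, mom (c j) (Lof I x k) - ∑ j, mom (d j) (Lof I x k)) := by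
  unfold Fsl
  rw [ind_xhat, one_mul, corr_xhat I c d _ x h1, add_zero, Finset.sum_comm]
  rw [← Fin.sum_univ_eq_sum_range (fun k => ((-1 : ℂ) ^ k *
      (((x I.b).choose k * (deg (xhat I x) + (x I.c - 1 - k)).choose (x I.c - k) : ℕ) : ℂ)) *
        (∑ j, mom (c j) (Lof I x k) - ∑ j, mom (d j) (Lof I x k))) (x I.c + 1)]
  refine Finset.sum_congr rfl fun k _ => ?_
  simp only [mainTerm_xhat]
  rw [Fintype.sum_sum_type]
  simp only [sgn, tab, Sum.elim_inl, Sum.elim_inr, one_mul, neg_one_mul, Finset.sum_neg_distrib,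
    ← Finset.mul_sum]
  unfold mom
  ring


omit [Fintype σ] [DecidableEq σ] in
/-- The two spellings of the letter-count binomial agree on the admissible range. [folklore] -/
theorem choose_bridge (D xc k : ℕ) (hk : k ≤ xc) (hD : 1 ≤ D) :
    (D + (xc - 1 - k)).choose (xc - k) = (D + xc - 1 - k).choose (xc - k) := by
  rcases Nat.lt_or_ge k xc with h | h
  · congr 1; omega
  · have h0 : xc - k = 0 := by omega
    rw [h0, Nat.choose_zero_right, Nat.choose_zero_right]

/-- **THE COEFFICIENT THEOREM** (non-exceptional exponents, `deg x̂ ≥ 1`): for `x` with `x_a = 0` and `deg x ≤ R`, the coefficient of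
`Y^x` in the free lift of the truncated logarithm is `(-1)^{deg x + 1} · Pfac(x) · F_{x_c}(x̂)`. [folklore] -/
theorem coeff_free_logTrunc (c d : Fin m → σ → ℂ) (R : ℕ) (x : σ →₀ ℕ) (hx : x I.a = 0)
    (h1 : 1 ≤ deg (xhat I x)) (hR : deg x ≤ R) :
    coeff x (phiT (frM I) (logTrunc c d R)) = (-1 : ℂ) ^ (deg x + 1) * Pfac I x * Fsl I c d (x I.c) ⇑(xhat I x) := by
  classical
  rw [coeff_phiT_frM I _ x hx]
  have hdx : deg x = deg (xhat I x) + x I.c := by rw [deg_eq_deg_xhat_add I x, hx, zero_add]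
  have step2 : ∀ k ∈ KR I x, coeff (Lof I x k) (logTrunc c d R) =
      (-1 : ℂ) ^ (deg x + 1) * Pfac I x * (((-1 : ℂ) ^ k *
        (((x I.b).choose k * (deg (xhat I x) + (x I.c - 1 - k)).choose (x I.c - k) : ℕ) : ℂ)) *
          (∑ j, mom (c j) (Lof I x k) - ∑ j, mom (d j) (Lof I x k))) := by
    intro k hk
    have hk' := (mem_KR I x k).1 hk
    have hdeg := deg_Lof I x k hk
    have hdeg1 : 1 ≤ deg (Lof I x k) := by omega
    have hdegR : deg (Lof I x k) ≤ R := by omega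
    rw [coeff_logTrunc c d R _ hdeg1 hdegR]
    have hsign : (-1 : ℂ) ^ (deg (Lof I x k) + 1) = (-1) ^ (deg x + 1) * (-1) ^ k := by
      have e : deg x + 1 = (deg (Lof I x k) + 1) + k := by omega
      rw [e, pow_add (-1 : ℂ) (deg (Lof I x k) + 1) k, mul_assoc, ← pow_add (-1 : ℂ) k k, ← two_mul,
        pow_mul]
      norm_num
    have hn0 : ((deg (Lof I x k) : ℕ) : ℂ) ≠ 0 := Nat.cast_ne_zero.mpr (by omega)
    have hM : ((Lof I x k).multinomial : ℂ) = Pfac I x *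
        (((x I.b).choose k * (deg (xhat I x) + x I.c - 1 - k).choose (x I.c - k) : ℕ) : ℂ) *
          ((deg (Lof I x k) : ℕ) : ℂ) := (div_eq_iff hn0).mp (multinomial_Lof_div I x k hk h1)
    rw [← choose_bridge (deg (xhat I x)) (x I.c) k hk'.2 h1] at hM
    rw [hM, hsign]
    field_simp
  rw [Finset.sum_congr rfl step2, ← Finset.mul_sum, Fsl_xhat_eq I c d x h1]
  rw [← Finset.sum_subset (show KR I x ⊆ Finset.range (x I.c + 1) from fun k hk =>
      Finset.mem_range.mpr (Nat.lt_succ_of_le ((mem_KR I x k).1 hk).2)) (fun k hk hnk => by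
    rw [mem_KR] at hnk
    have hk' : k ≤ x I.c := Nat.lt_succ_iff.mp (Finset.mem_range.mp hk)
    have : (x I.b).choose k * (deg (xhat I x) + (x I.c - 1 - k)).choose (x I.c - k) = 0 := by
      rw [Nat.choose_eq_zero_of_lt (by omega : x I.b < k), zero_mul]
    rw [this, Nat.cast_zero, mul_zero, zero_mul])]

/-- The fibre element with `k = 0` is `x` itself. [folklore] -/
theorem Lof_zero (x : σ →₀ ℕ) (hx : x I.a = 0) : Lof I x 0 = x := by
  ext j
  by_cases hja : j = I.a
  · subst hja; rw [Lof_a, hx]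
  by_cases hjb : j = I.b
  · subst hjb; rw [Lof_b, Nat.sub_zero]
  by_cases hjc : j = I.c
  · subst hjc; rw [Lof_c, Nat.sub_zero]
  rw [Lof_other I x 0 j hja hjb hjc]

/-- The exceptional exponents of a slice: `x̂ = 0`, i.e. `x = b · e_c`. [folklore] -/
theorem exc_apply (x : σ →₀ ℕ) (hx : x I.a = 0) (h0 : deg (xhat I x) = 0) (j : σ) (hj : j ≠ I.c) : x j = 0 := by
  have hz : xhat I x = 0 := (deg_eq_zero_iff _).mp h0
  by_cases hja : j = I.a
  · rw [hja, hx]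
  · have := DFunLike.congr_fun hz j
    rwa [xhat_other I x j hja hj] at this

/-- The multinomial coefficient of an exceptional exponent is `1`. [folklore] -/
theorem multinomial_exc (x : σ →₀ ℕ) (hx : x I.a = 0) (h0 : deg (xhat I x) = 0) : x.multinomial = 1 := by
  have s := Nat.multinomial_spec (Finset.univ : Finset σ) x
  rw [← multinomial_univ, ← deg_eq_sum, prod_three_split I, hx, exc_apply I x hx h0 I.b I.hbc,
    deg_eq_deg_xhat_add I x, h0, hx] at s
  have hr : ∏ j ∈ rest I, (x j).factorial = 1 := by
    refine Finset.prod_eq_one fun j hj => ?_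
    rw [mem_rest] at hj
    rw [exc_apply I x hx h0 j hj.2.2, Nat.factorial_zero]
  rw [hr, Nat.factorial_zero] at s
  have hpos : 0 < (x I.c).factorial := Nat.factorial_pos _
  apply Nat.eq_of_mul_eq_mul_left hpos
  simpa using s

/-- Moments of an exceptional exponent. [folklore] -/
theorem mom_exc (t : σ → ℂ) (x : σ →₀ ℕ) (hx : x I.a = 0) (h0 : deg (xhat I x) = 0) : mom t x = t I.c ^ x I.c := by
  unfold mom
  rw [prod_three_split I, hx, exc_apply I x hx h0 I.b I.hbc, pow_zero, pow_zero, one_mul, one_mul]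
  have hr : ∏ j ∈ rest I, t j ^ x j = 1 := by
    refine Finset.prod_eq_one fun j hj => ?_
    rw [mem_rest] at hj
    rw [exc_apply I x hx h0 j hj.2.2, pow_zero]
  rw [hr, one_mul]

/-- The slice function at the exceptional point: `F_b(0) = Σ_j ± c_{jγ}^b` for `b ≥ 1`. [folklore] -/
theorem Fsl_exc (c d : Fin m → σ → ℂ) (b₀ : ℕ) (hb : 1 ≤ b₀) (ν : σ → ℕ) (hν : ∀ j, ν j = 0) :
    Fsl I c d b₀ ν = ∑ j, mom (c j) (ofFun fun i => if i = I.c then b₀ else 0) -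
      ∑ j, mom (d j) (ofFun fun i => if i = I.c then b₀ else 0) := by
  have hmain : ∑ j : Fin m ⊕ Fin m, ∑ k : Fin (b₀ + 1), mainTerm I c d b₀ j k ν = 0 := by
    refine Finset.sum_eq_zero fun j _ => Finset.sum_eq_zero fun k _ => ?_
    unfold mainTerm
    rcases Nat.eq_zero_or_pos (k : ℕ) with hk | hk
    · have hlam : lam I ν = 0 := by unfold lam; simp [hν]
      rw [hk, hlam, Nat.choose_eq_zero_of_lt (by omega : 0 + (b₀ - 1 - 0) < b₀ - 0)]
      simp
    · rw [hν I.b, binChar_eq_zero_of_lt _ _ _ hk]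
      simp
  have hmom : ∀ t : σ → ℂ, mom t (ofFun fun i => if i = I.c then b₀ else 0) = t I.c ^ b₀ := by
    intro t
    unfold mom
    rw [prod_three_split I]
    have hr : ∏ j ∈ rest I, t j ^ (ofFun fun i => if i = I.c then b₀ else 0) j = 1 := by
      refine Finset.prod_eq_one fun j hj => ?_
      rw [mem_rest] at hj
      simp [hj.2.2]
    rw [hr]
    simp [I.hac, I.hbc]
  unfold Fsl
  rw [hmain, mul_zero, zero_add]
  unfold corr
  rw [if_pos hν, Fintype.sum_sum_type]
  simp only [sgn, tab, Sum.elim_inl, Sum.elim_inr, one_mul, neg_one_mul, Finset.sum_neg_distrib, hmom]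
  ring

/-- **THE COEFFICIENT THEOREM at the exceptional exponent** `x = b · e_c` (`b ≥ 1`). [folklore] -/
theorem coeff_free_logTrunc_exc (c d : Fin m → σ → ℂ) (R : ℕ) (x : σ →₀ ℕ) (hx : x I.a = 0)
    (h0 : deg (xhat I x) = 0) (hc : 1 ≤ x I.c) (hR : deg x ≤ R) :
    coeff x (phiT (frM I) (logTrunc c d R)) =
      ((-1 : ℂ) ^ (x I.c + 1) / ((x I.c : ℕ) : ℂ)) * Fsl I c d (x I.c) ⇑(xhat I x) := by
  classical
  rw [coeff_phiT_frM I _ x hx]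
  have hdx : deg x = x I.c := by rw [deg_eq_deg_xhat_add I x, hx, h0, zero_add, zero_add]
  have hKR : KR I x = {0} := by
    unfold KR; rw [exc_apply I x hx h0 I.b I.hbc, Nat.zero_min, zero_add, Finset.range_one]
  rw [hKR, Finset.sum_singleton, Lof_zero I x hx, coeff_logTrunc c d R x (by omega) hR, hdx, multinomial_exc I x hx h0,
    Nat.cast_one, one_mul]
  have hz : ∀ j, (xhat I x) j = 0 := fun j => by rw [(deg_eq_zero_iff _).mp h0]; rfl
  rw [Fsl_exc I c d (x I.c) hc _ hz]
  have hxe : x = ofFun fun i => if i = I.c then x I.c else 0 := by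
    ext j
    by_cases hj : j = I.c
    · subst hj; simp
    · rw [exc_apply I x hx h0 j hj]; simp [hj]
  rw [← hxe]

/-- **The support criterion**: `x ≠ 0` with `x_a = 0` and `deg x ≤ R` lies in the support of the free lift of `Λ_R` iff
`F_{x_c}(x̂) ≠ 0`. [folklore] -/
theorem mem_support_free_logTrunc_iff (c d : Fin m → σ → ℂ) (R : ℕ) (x : σ →₀ ℕ) (hx : x I.a = 0) (hne : x ≠ 0)
    (hR : deg x ≤ R) :
    x ∈ (phiT (frM I) (logTrunc c d R)).support ↔ Fsl I c d (x I.c) ⇑(xhat I x) ≠ 0 := by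
  rw [mem_support_iff]
  by_cases h1 : 1 ≤ deg (xhat I x)
  · rw [coeff_free_logTrunc I c d R x hx h1 hR]
    have hc : (-1 : ℂ) ^ (deg x + 1) * Pfac I x ≠ 0 :=
      mul_ne_zero (pow_ne_zero _ (neg_ne_zero.mpr one_ne_zero)) (Pfac_ne_zero I x)
    constructor
    · intro h hF; exact h (by rw [hF, mul_zero])
    · intro h; exact mul_ne_zero hc h
  · have h0 : deg (xhat I x) = 0 := by omega
    have hdx : deg x = x I.c := by rw [deg_eq_deg_xhat_add I x, hx, h0, zero_add, zero_add]
    have hc1 : 1 ≤ x I.c := by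
      by_contra h
      apply hne
      apply (deg_eq_zero_iff x).mp
      omega
    rw [coeff_free_logTrunc_exc I c d R x hx h0 hc1 hR]
    have hc : ((-1 : ℂ) ^ (x I.c + 1) / ((x I.c : ℕ) : ℂ)) ≠ 0 :=
      div_ne_zero (pow_ne_zero _ (neg_ne_zero.mpr one_ne_zero)) (Nat.cast_ne_zero.mpr (by omega))
    constructor
    · intro h hF; exact h (by rw [hF, mul_zero])
    · intro h; exact mul_ne_zero hc h

/-- Non-vanishing of a slice function forces `ν_a = ν_c = 0`. [folklore] -/
theorem shape_of_Fsl_ne_zero (c d : Fin m → σ → ℂ) (b₀ : ℕ) (ν : σ → ℕ) (h : Fsl I c d b₀ ν ≠ 0) :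
    ν I.a = 0 ∧ ν I.c = 0 := by
  by_contra hcon
  apply h
  unfold Fsl ind corr
  rw [if_neg hcon, zero_mul, zero_add, if_neg]
  intro hall
  exact hcon ⟨hall I.a, hall I.c⟩

/-- The slice function of the slice `b = 0` vanishes at the origin (equal numbers of `±` atoms). [folklore] -/
theorem Fsl_zero_zero (c d : Fin m → σ → ℂ) (ν : σ → ℕ) (hν : ∀ j, ν j = 0) : Fsl I c d 0 ν = 0 := by
  have hmain : ∀ j : Fin m ⊕ Fin m, ∑ k : Fin (0 + 1), mainTerm I c d 0 j k ν = sgn m j := by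
    intro j
    rw [Fin.sum_univ_one]
    unfold mainTerm binChar restProd
    simp [hν]
  unfold Fsl corr
  simp only [hmain, sum_sgn, mul_zero, zero_add]
  rw [if_pos hν]
  simp only [pow_zero, mul_one, sum_sgn]

/-- The exponent with prescribed slice `b` and reduced part `ν` (`ν_a = ν_c = 0`). [folklore] -/
def xOf (b₀ : ℕ) (ν : σ → ℕ) : σ →₀ ℕ :=
  ofFun fun j => if j = I.c then b₀ else if j = I.a then 0 else ν j

/-- The prescribed slice coordinate. [folklore] -/
theorem xOf_c (b₀ : ℕ) (ν : σ → ℕ) : xOf I b₀ ν I.c = b₀ := by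
  simp [xOf]

/-- The `a`-coordinate of `xOf` vanishes. [folklore] -/
theorem xOf_a (b₀ : ℕ) (ν : σ → ℕ) : xOf I b₀ ν I.a = 0 := by
  simp [xOf, I.hac]

/-- The reduced part of `xOf b ν` is `ν`. [folklore] -/
theorem xhat_xOf (b₀ : ℕ) (ν : σ → ℕ) (ha : ν I.a = 0) (hc : ν I.c = 0) : ⇑(xhat I (xOf I b₀ ν)) = ν := by
  funext j
  by_cases hja : j = I.a
  · subst hja; rw [xhat_a, ha]
  by_cases hjc : j = I.c
  · subst hjc; rw [xhat_c, hc]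
  rw [xhat_other I _ j hja hjc]
  simp [xOf, hja, hjc]

/-- An exponent with `x_a = 0` is recovered from its slice and its reduced part. [folklore] -/
theorem xOf_xhat (x : σ →₀ ℕ) (hx : x I.a = 0) : xOf I (x I.c) ⇑(xhat I x) = x := by
  ext j
  by_cases hjc : j = I.c
  · subst hjc; rw [xOf_c]
  by_cases hja : j = I.a
  · subst hja; rw [xOf_a, hx]
  simp [xOf, hjc, hja, xhat_other I x j hja hjc]

end Slice

end R6b
end Summit.ValiantsHypothesis.ValiantsHypothesis.Theorems.NewtonUnitEquations.TwoProducts.PermutationType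

end
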